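import Summits.ResolutionOfSingularities.ResolutionOfSingularities.Theorems.FrobeniusLadderFRationalResolutionChartAlgebraOrthantPoints
import Summits.ResolutionOfSingularities.ResolutionOfSingularities.Theorems.FrobeniusLadderFRationalResolutionVertexChartMonoid
import Summits.ResolutionOfSingularities.ResolutionOfSingularities.Theorems.FrobeniusLadderFRationalResolutionAdaptedBasisOrthant
import HarnessLib

/-!
# Crux `FrobeniusLadder.FRationalResolution` (stmt-ResolutionOfSingularities-15317), line `redirect`,
# stub `stub_diagonalizableQuotientResolution` — **termination of the point-blow-up recursion: vertex
# charts with parameter `c ≤ 1` are orthant-like, hence regular at every prime** (surface case over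
# arbitrary fields, memo MEMO-15317-leafhand2-g6 §4 / MEMO-15317-leafhand2-g7 remaining item (2))

A vertex chart monoid `Q = L + {m v + l x : m ≥ 0, m + c l ≥ 0}` with `c = 0` is `L ⊕ ℕv ⊕ ℤx`, and with
`c = 1` it is `L ⊕ ℕx ⊕ ℕ(v − x)` (free): both are `ℕ^I ⊕ ℤ^{Iᶜ}` in a `ℤ`-basis of `ℤⁿ`
(`…AdaptedBasisOrthant`), so a chart algebra `C = A[χ(Q)]` over a chart `φ` log regular at `𝔓 ∩ A` has
ALL its local rings `C_𝔓` regular by Kato (10.3) one prime at a time (`…ChartAlgebraOrthantPoints`).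
Since the parameter drops by `2` per blow-up along the fixed points (`…VertexChartMonoid`,
`…VertexChartBlowup`), this is where the recursion stops.

* `exists_isOrthantLike_of_param_zero`, `exists_isOrthantLike_of_param_one`;
* **`isRegularLocalRing_of_param_le_one`**.

Honest label: assembly toward ONE leaf stub (no stub, crux or summit closed). No definitions, no named
facts, no sorry. [cite: Kato1994, (10.1), (10.3)]
-/

noncomputable section

-- single-problem summit: the doubled namespace component is forced
set_option linter.dupNamespace false

open IsLocalRing Literature.AlgebraicGeometry.Resolution Literature.AlgebraicGeometry.Resolution.LogChart
  Literature.AlgebraicGeometry.Resolution.LogRefinedChart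
open Summit.ResolutionOfSingularities.ResolutionOfSingularities.Theorems.FRationalResolution.ChartAlgebraOrthantPoints
open Summit.ResolutionOfSingularities.ResolutionOfSingularities.Theorems.FRationalResolution.VertexChartMonoid
open Summit.ResolutionOfSingularities.ResolutionOfSingularities.Theorems.FRationalResolution.AdaptedBasisOrthant

namespace Summit.ResolutionOfSingularities.ResolutionOfSingularities.Theorems.FRationalResolution.VertexChartSmallParameter

universe u

variable {n : ℕ} {L : Submodule ℤ (Fin n → ℤ)} {Q : AddSubmonoid (Fin n → ℤ)} {v x : Fin n → ℤ} {c : ℕ}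

/-- **`c = 0`: the vertex chart is `L ⊕ ℕv ⊕ ℤx`, orthant-like.** [cite: Kato1994, (10.1)] -/
theorem exists_isOrthantLike_of_param_zero (hc : c = 0)
    (hQ : ∀ w, w ∈ Q ↔ ∃ g ∈ L, ∃ m l : ℤ, 0 ≤ m ∧ 0 ≤ m + (c : ℤ) * l ∧ w = g + m • v + l • x)
    (hind : ∀ g ∈ L, ∀ m l : ℤ, g + m • v + l • x = 0 → m = 0 ∧ l = 0)
    (hspan : ∀ w : Fin n → ℤ, ∃ g ∈ L, ∃ m l : ℤ, w = g + m • v + l • x) :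
    ∃ (b : Module.Basis (Fin n) ℤ (Fin n → ℤ)) (I : Finset (Fin n)), IsOrthantLike b I Q := by
  subst hc
  refine exists_isOrthantLike_of_mem_iff hind hspan {0} fun w => ?_
  rw [hQ w]
  constructor
  · rintro ⟨g, hg, m, l, hm, -, h⟩; exact ⟨g, hg, m, l, fun _ => hm, by simp, h⟩
  · rintro ⟨g, hg, m, l, hm, -, h⟩; exact ⟨g, hg, m, l, hm (by simp), by simpa using hm (by simp), h⟩

/-- **`c = 1`: the vertex chart is `L ⊕ ℕx ⊕ ℕ(v − x)`, orthant-like** (`m v + l x = (m + l) x + m (v − x)`).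
[cite: Kato1994, (10.1)] -/
theorem exists_isOrthantLike_of_param_one (hc : c = 1)
    (hQ : ∀ w, w ∈ Q ↔ ∃ g ∈ L, ∃ m l : ℤ, 0 ≤ m ∧ 0 ≤ m + (c : ℤ) * l ∧ w = g + m • v + l • x)
    (hind : ∀ g ∈ L, ∀ m l : ℤ, g + m • v + l • x = 0 → m = 0 ∧ l = 0)
    (hspan : ∀ w : Fin n → ℤ, ∃ g ∈ L, ∃ m l : ℤ, w = g + m • v + l • x) :
    ∃ (b : Module.Basis (Fin n) ℤ (Fin n → ℤ)) (I : Finset (Fin n)), IsOrthantLike b I Q := by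
  subst hc
  have hind' : ∀ g ∈ L, ∀ m l : ℤ, g + m • x + l • (v - x) = 0 → m = 0 ∧ l = 0 := by
    intro g hg m l h
    have h1 : g + l • v + (m - l) • x = 0 := by rw [← h]; module
    have := hind g hg _ _ h1
    omega
  have hspan' : ∀ w : Fin n → ℤ, ∃ g ∈ L, ∃ m l : ℤ, w = g + m • x + l • (v - x) := by
    intro w
    obtain ⟨g, hg, m, l, rfl⟩ := hspan w
    exact ⟨g, hg, m + l, m, by module⟩
  refine exists_isOrthantLike_of_mem_iff hind' hspan' Finset.univ fun w => ?_
  rw [hQ w]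
  constructor
  · rintro ⟨g, hg, m, l, hm, hml, rfl⟩
    refine ⟨g, hg, m + l, m, fun _ => by push_cast at hml; omega, fun _ => hm, by module⟩
  · rintro ⟨g, hg, m, l, hm, hl, rfl⟩
    refine ⟨g, hg, l, m - l, hl (Finset.mem_univ _), by push_cast; have := hm (Finset.mem_univ _); omega,
      by module⟩

variable {A : Type u} [CommRing A] [IsNoetherianRing A] {P : AddSubmonoid (Fin n → ℤ)}
  {φ : Multiplicative P →* A} {𝔭 : Ideal A} [𝔭.IsPrime] {C : Type u} [CommRing C] [Algebra A C]
  {χ : Multiplicative Q →* C}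

/-- **Termination: vertex chart algebras with parameter `c ≤ 1` are regular.** For a chart algebra
`C = A[χ(Q)]` over an fs spanning chart `φ` ((χ), (gen), (Ω)), `Q` a vertex chart monoid relative to
`L = ℤF_𝔭` with `c ≤ 1`, and a prime `𝔓` of `C` with `φ` log regular at `𝔓 ∩ A`: `C_𝔓` is a regular
local ring. [cite: Kato1994, (10.3)] -/
theorem isRegularLocalRing_of_param_le_one (hc : c ≤ 1) (hP : P.FG)
    (hsat : ∀ (w : Fin n → ℤ) (k : ℕ), 0 < k → k • w ∈ P → w ∈ P)
    (hspanP : Submodule.span ℤ (P : Set (Fin n → ℤ)) = ⊤) (hPQ : P ≤ Q)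
    (hχ : ∀ p : P, χ (Multiplicative.ofAdd ⟨(p : Fin n → ℤ), hPQ p.2⟩) =
      algebraMap A C (φ (Multiplicative.ofAdd p)))
    (hgen : Algebra.adjoin A (Set.range χ) = ⊤)
    (hΩ : ∀ (K : Type u) [Field K] (g : A →+* K), (∀ p : P, g (φ (Multiplicative.ofAdd p)) ≠ 0) →
      ∃ ω : C →+* K, ω.comp (algebraMap A C) = g)
    (hQ : ∀ w, w ∈ Q ↔ ∃ g ∈ Submodule.span ℤ (faceMonoid P φ 𝔭 : Set (Fin n → ℤ)), ∃ m l : ℤ,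
      0 ≤ m ∧ 0 ≤ m + (c : ℤ) * l ∧ w = g + m • v + l • x)
    (hind : ∀ g ∈ Submodule.span ℤ (faceMonoid P φ 𝔭 : Set (Fin n → ℤ)), ∀ m l : ℤ,
      g + m • v + l • x = 0 → m = 0 ∧ l = 0)
    (hspan : ∀ w : Fin n → ℤ, ∃ g ∈ Submodule.span ℤ (faceMonoid P φ 𝔭 : Set (Fin n → ℤ)),
      ∃ m l : ℤ, w = g + m • v + l • x)
    (𝔓 : Ideal C) [𝔓.IsPrime] (hreg : IsLogRegularAt P φ (𝔓.comap (algebraMap A C))) :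
    IsRegularLocalRing (Localization.AtPrime 𝔓) := by
  obtain ⟨b, I, hI⟩ : ∃ (b : Module.Basis (Fin n) ℤ (Fin n → ℤ)) (I : Finset (Fin n)),
      IsOrthantLike b I Q := by
    rcases Nat.le_one_iff_eq_zero_or_eq_one.1 hc with h | h
    · exact exists_isOrthantLike_of_param_zero h hQ hind hspan
    · exact exists_isOrthantLike_of_param_one h hQ hind hspan
  exact isRegularLocalRing_localization_of_isOrthantLike hP hsat hspanP hI hPQ hχ hgen hΩ 𝔓 hreg

end Summit.ResolutionOfSingularities.ResolutionOfSingularities.Theorems.FRationalResolution.VertexChartSmallParameter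

end
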